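import Mathlib
import Literature.NumberTheory.Transcendental.KZCalculusProofs
import Literature.NumberTheory.Transcendental.KZLogCalculusProofs
import Literature.NumberTheory.Transcendental.KZSemialgebraicComplex
import Summits.KontsevichZagierPeriods.KontsevichZagierPeriods.Theorems.HyperbolicBlochOffTetraSectorKernelWeightOneEnvelope
import Summits.KontsevichZagierPeriods.KontsevichZagierPeriods.Theorems.HyperbolicBlochOffTetraSectorKernelStubSphereFan
import Summits.KontsevichZagierPeriods.KontsevichZagierPeriods.Theorems.HyperbolicBlochOffTetraSectorKernelStubSphereRadial
import Summits.KontsevichZagierPeriods.KontsevichZagierPeriods.Theorems.HyperbolicBlochOffTetraSectorKernelStubSphereFanExists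
import Summits.KontsevichZagierPeriods.KontsevichZagierPeriods.Theorems.HyperbolicBlochOffTetraSectorKernelStubSphereRotation

/-!
# `OffTetraSectorKernel`, line `odd-hyperbolic-ladder` (v10): THE SPHERICAL RUNG 1 — Girard inside the calculus

Stereographic chart of the unit sphere from the north pole: area density `ω = 4/(1+x²+y²)²`; the great circles not through the
poles are the circles `|z − c|² = 1 + |c|²`, rationally parametrised by `p(τ) = (c₁ + R(1−τ²)/(1+τ²), c₂ + 2Rτ/(1+τ²))`,
`R² = 1 + c₁² + c₂²`. The GEODESIC FAN from the south pole over the arc `p((τ₁,τ₂))` — a spherical triangle with a vertex at the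
south pole — is the image of `(τ₁,τ₂) × (0,1)` under `Φ(τ,λ) = λ·p(τ)`. MAGIC IDENTITY: `(p × p′)(1+τ²) = 1 + |p|²`, whence
GIRARD'S THEOREM IN RATIONAL FORM: `[fan, ω] ≡ [(τ₁,τ₂), 2/(1+τ²)]` (area `2(arctan τ₂ − arctan τ₁)`) by TWO moves — the fan map
(rule (2), `stub_sphereFan`) and one Newton–Leibniz move along `λ` (rule (3), `stub_sphereRadial`). Consequently every geodesic
fan, and (`stub_sphereRotation`: rotations of `S²` are isometries of the chart) every rotated fan, i.e. every `ℚ̄`-spherical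
triangle in fan presentation, lies in `relations ⊔ closure(G)` for the weight-one envelope `G` of skeleton v7, and Baker's
theorem GLUES SPHERICAL AREAS to hyperbolic lengths, hyperbolic areas, Euclidean volumes and `π`:
`eval.ker ⊓ closure (G ∪ Fans) ≤ relations` (`sphericalRungOne_inf_ker_le_relations`). All three constant-curvature rung-1
geometries now glue.

References: A. Girard, *Invention nouvelle en l'algèbre* (1629); M. Kontsevich, D. Zagier, *Periods* (2001), §1.2;
A. Baker, *Transcendental Number Theory* (1975), Thm. 2.1.
-/

noncomputable section

open Set MeasureTheory
open Literature.NumberTheory.Transcendental Literature.ModelTheory.ExponentialFields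

namespace Summit.KontsevichZagierPeriods.HyperbolicBloch.OffTetraSectorKernel

/-! ### Girard in rational form: a geodesic fan is twice an arctangent carrier -/

/-- **GIRARD'S THEOREM INSIDE THE CALCULUS**: for any density representation `T` on the geodesic fan over the arc
`p((τ₁,τ₂))` and any arctangent carrier `A = [(τ₁,τ₂), 2/(1+τ²)]`, `[T] − [A] ∈ KZ.relations` (two moves through the
pulled-back rectangle `W`: `stub_sphereFan`, `stub_sphereRadial`; `W` exists by `stub_sphereFanExists`).
[cite: KontsevichZagier2001, §1.2] -/
theorem sphericalFan_sub_arctan_mem_relations :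
    ∀ (c₁ c₂ R τ₁ τ₂ : ℝ), IsAlgebraic ℚ c₁ → IsAlgebraic ℚ c₂ → IsAlgebraic ℚ R → IsAlgebraic ℚ τ₁ → IsAlgebraic ℚ τ₂ →
      0 < R → R ^ 2 = 1 + c₁ ^ 2 + c₂ ^ 2 → τ₁ < τ₂ →
    ∀ (T : KZ.IntegralRep 2) (A : KZ.IntegralRep 1),
      T.domain = (fun z : Fin 2 → ℝ => ![z 1 * (c₁ + R * (1 - z 0 ^ 2) / (1 + z 0 ^ 2)), z 1 * (c₂ + 2 * R * z 0 / (1 + z 0 ^ 2))]) ''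
        {z | τ₁ < z 0 ∧ z 0 < τ₂ ∧ 0 < z 1 ∧ z 1 < 1} →
      Set.EqOn T.integrand (fun p => 4 / (1 + p 0 ^ 2 + p 1 ^ 2) ^ 2) T.domain →
      A.domain = {q | τ₁ < q 0 ∧ q 0 < τ₂} →
      Set.EqOn A.integrand (fun q => 2 / (1 + q 0 ^ 2)) A.domain →
      KZ.of T - KZ.of A ∈ KZ.relations := by
  intro c₁ c₂ R τ₁ τ₂ h₁ h₂ hR' ht₁ ht₂ hR0 hR hτ T A hT hTi hA hAi
  obtain ⟨⟨W, hWd, hWi⟩, -, -⟩ := stub_sphereFanExists c₁ c₂ R τ₁ τ₂ h₁ h₂ hR' ht₁ ht₂ hR0 hR hτ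
  have hfan := stub_sphereFan c₁ c₂ R τ₁ τ₂ h₁ h₂ hR' ht₁ ht₂ hR0 hR hτ W T hWd (fun z _ => by rw [hWi])
    (by rw [hT, hWd]) hTi
  have hrad := stub_sphereRadial c₁ c₂ R τ₁ τ₂ h₁ h₂ hR' ht₁ ht₂ hR0 hR hτ W A hWd (fun z _ => by rw [hWi]) hA hAi
  have : KZ.of T - KZ.of A = (KZ.of W - KZ.of A) - (KZ.of W - KZ.of T) := by abel
  rw [this]
  exact KZ.relations.sub_mem hrad hfan

/-- The arctangent carrier `[(τ₁,τ₂), 2/(1+τ²)]` is a RATIONAL representation of dimension `1` (KZ's literal shape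
`p/q`, `p = 2`, `q = 1 + X₀²`), hence a generator of the weight-one envelope. [cite: KontsevichZagier2001, §1.1] -/
theorem sphericalArctan_isRational (A : KZ.IntegralRep 1)
    (hAi : EqOn A.integrand (fun q => 2 / (1 + q 0 ^ 2)) A.domain) : A.IsRational := by
  refine ⟨MvPolynomial.C 2, 1 + MvPolynomial.X 0 ^ 2, fun x _ => ?_, fun x hx => ?_⟩
  · simp only [map_add, map_one, map_pow, MvPolynomial.aeval_X]
    positivity
  · rw [hAi hx]
    simp [MvPolynomial.aeval_X]

/-- **Every geodesic fan lies in `relations ⊔ closure(G)`** for the weight-one envelope `G`: `[T] = ([T] − [A]) + [A]` with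
`[A]` a rational generator of dimension `1` (an arctangent carrier exists on `(τ₁,τ₂)`, `stub_sphereFanExists`).
[cite: KontsevichZagier2001, §1.2] -/
theorem sphericalFan_mem_relations_sup_envelope {c : KZ.FormalRep}
    (hc : c ∈ {y : KZ.FormalRep | ∃ (c₁ c₂ R τ₁ τ₂ : ℝ) (T : KZ.IntegralRep 2), IsAlgebraic ℚ c₁ ∧ IsAlgebraic ℚ c₂ ∧
          IsAlgebraic ℚ R ∧ IsAlgebraic ℚ τ₁ ∧ IsAlgebraic ℚ τ₂ ∧ 0 < R ∧ R ^ 2 = 1 + c₁ ^ 2 + c₂ ^ 2 ∧ τ₁ < τ₂ ∧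
          T.domain = (fun z : Fin 2 → ℝ => ![z 1 * (c₁ + R * (1 - z 0 ^ 2) / (1 + z 0 ^ 2)), z 1 * (c₂ + 2 * R * z 0 / (1 + z 0 ^ 2))]) ''
            {z | τ₁ < z 0 ∧ z 0 < τ₂ ∧ 0 < z 1 ∧ z 1 < 1} ∧
          EqOn T.integrand (fun p => 4 / (1 + p 0 ^ 2 + p 1 ^ 2) ^ 2) T.domain ∧ y = KZ.of T}) :
    c ∈ KZ.relations ⊔ AddSubgroup.closure
      ({y : KZ.FormalRep | ∃ r : KZ.IntegralRep 1, KZ.IsGeodesicPolytope 0 r.domain ∧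
          EqOn r.integrand (KZ.hypDensity 0) r.domain ∧ y = KZ.of r} ∪
        {y | ∃ r : KZ.IntegralRep 2, KZ.IsGeodesicPolytope 1 r.domain ∧
          EqOn r.integrand (KZ.hypDensity 1) r.domain ∧ y = KZ.of r} ∪
        {y | ∃ (d : ℕ) (A : Matrix (Fin d) (Fin d) ℝ) (b : Fin d → ℝ) (r : KZ.IntegralRep d),
          (∀ j l, IsAlgebraic ℚ (A j l)) ∧ (∀ j, IsAlgebraic ℚ (b j)) ∧ A.det ≠ 0 ∧
          r.domain = (fun x => A.mulVec x + b) '' {x | (∀ i, 0 < x i) ∧ ∑ i, x i < 1} ∧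
          (∀ x ∈ r.domain, r.integrand x = 1) ∧ y = KZ.of r} ∪
        {y | ∃ (A : Matrix (Fin 2) (Fin 2) ℝ) (b : Fin 2 → ℝ) (r : KZ.IntegralRep 2),
          (∀ j l, IsAlgebraic ℚ (A j l)) ∧ (∀ j, IsAlgebraic ℚ (b j)) ∧ A.det ≠ 0 ∧
          r.domain = (fun x => A.mulVec x + b) '' {p | p 0 ^ 2 + p 1 ^ 2 < 1} ∧
          (∀ x ∈ r.domain, r.integrand x = 1) ∧ y = KZ.of r} ∪
        {y | ∃ (m : ℕ) (N : KZ.IntegralRep m), m ≤ 1 ∧ N.IsRational ∧ y = KZ.of N}) := by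
  obtain ⟨c₁, c₂, R, τ₁, τ₂, T, h₁, h₂, hR', ht₁, ht₂, hR0, hR, hτ, hT, hTi, rfl⟩ := hc
  obtain ⟨-, -, ⟨A, hAd, hAi⟩⟩ := stub_sphereFanExists c₁ c₂ R τ₁ τ₂ h₁ h₂ hR' ht₁ ht₂ hR0 hR hτ
  have h := sphericalFan_sub_arctan_mem_relations c₁ c₂ R τ₁ τ₂ h₁ h₂ hR' ht₁ ht₂ hR0 hR hτ T A hT hTi hAd
    (fun q _ => by rw [hAi])
  have hA : KZ.of A ∈ AddSubgroup.closure ({y : KZ.FormalRep | ∃ r : KZ.IntegralRep 1, KZ.IsGeodesicPolytope 0 r.domain ∧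
          EqOn r.integrand (KZ.hypDensity 0) r.domain ∧ y = KZ.of r} ∪
        {y | ∃ r : KZ.IntegralRep 2, KZ.IsGeodesicPolytope 1 r.domain ∧
          EqOn r.integrand (KZ.hypDensity 1) r.domain ∧ y = KZ.of r} ∪
        {y | ∃ (d : ℕ) (A : Matrix (Fin d) (Fin d) ℝ) (b : Fin d → ℝ) (r : KZ.IntegralRep d),
          (∀ j l, IsAlgebraic ℚ (A j l)) ∧ (∀ j, IsAlgebraic ℚ (b j)) ∧ A.det ≠ 0 ∧
          r.domain = (fun x => A.mulVec x + b) '' {x | (∀ i, 0 < x i) ∧ ∑ i, x i < 1} ∧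
          (∀ x ∈ r.domain, r.integrand x = 1) ∧ y = KZ.of r} ∪
        {y | ∃ (A : Matrix (Fin 2) (Fin 2) ℝ) (b : Fin 2 → ℝ) (r : KZ.IntegralRep 2),
          (∀ j l, IsAlgebraic ℚ (A j l)) ∧ (∀ j, IsAlgebraic ℚ (b j)) ∧ A.det ≠ 0 ∧
          r.domain = (fun x => A.mulVec x + b) '' {p | p 0 ^ 2 + p 1 ^ 2 < 1} ∧
          (∀ x ∈ r.domain, r.integrand x = 1) ∧ y = KZ.of r} ∪
        {y | ∃ (m : ℕ) (N : KZ.IntegralRep m), m ≤ 1 ∧ N.IsRational ∧ y = KZ.of N}) :=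
    AddSubgroup.subset_closure (Or.inr ⟨1, A, le_rfl, sphericalArctan_isRational A (fun q _ => by rw [hAi]), rfl⟩)
  have : KZ.of T = (KZ.of T - KZ.of A) + KZ.of A := by abel
  rw [this]
  exact AddSubgroup.add_mem _ (AddSubgroup.mem_sup_left h) (AddSubgroup.mem_sup_right hA)

/-- **Rotated geodesic fans** — `ℚ̄`-spherical triangles in fan presentation with the apex ANYWHERE — also lie in
`relations ⊔ closure(G)`: a rotation of the sphere (unitary Möbius map of the chart, `stub_sphereRotation`) carries the
fan representation (which exists, `stub_sphereFanExists`) onto the rotated one. [cite: KontsevichZagier2001, §1.2] -/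
theorem sphericalRotatedFan_mem_relations_sup_envelope {c : KZ.FormalRep}
    (hc : c ∈ {y : KZ.FormalRep | ∃ (a b : ℂ) (c₁ c₂ R τ₁ τ₂ : ℝ) (T' : KZ.IntegralRep 2), IsAlgebraic ℚ a.re ∧ IsAlgebraic ℚ a.im ∧
          IsAlgebraic ℚ b.re ∧ IsAlgebraic ℚ b.im ∧ Complex.normSq a + Complex.normSq b = 1 ∧ IsAlgebraic ℚ c₁ ∧
          IsAlgebraic ℚ c₂ ∧ IsAlgebraic ℚ R ∧ IsAlgebraic ℚ τ₁ ∧ IsAlgebraic ℚ τ₂ ∧ 0 < R ∧ R ^ 2 = 1 + c₁ ^ 2 + c₂ ^ 2 ∧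
          τ₁ < τ₂ ∧
          (∀ p ∈ (fun z : Fin 2 → ℝ => ![z 1 * (c₁ + R * (1 - z 0 ^ 2) / (1 + z 0 ^ 2)), z 1 * (c₂ + 2 * R * z 0 / (1 + z 0 ^ 2))]) '' {z | τ₁ < z 0 ∧ z 0 < τ₂ ∧ 0 < z 1 ∧ z 1 < 1},
            -(starRingEnd ℂ b) * (((p 0 : ℝ) : ℂ) + ((p 1 : ℝ) : ℂ) * Complex.I) + starRingEnd ℂ a ≠ 0) ∧
          T'.domain = (fun p : Fin 2 → ℝ =>
        ![((a * (((p 0 : ℝ) : ℂ) + ((p 1 : ℝ) : ℂ) * Complex.I) + b) / (-(starRingEnd ℂ b) * (((p 0 : ℝ) : ℂ) + ((p 1 : ℝ) : ℂ) * Complex.I) +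
            starRingEnd ℂ a)).re,
          ((a * (((p 0 : ℝ) : ℂ) + ((p 1 : ℝ) : ℂ) * Complex.I) + b) / (-(starRingEnd ℂ b) * (((p 0 : ℝ) : ℂ) + ((p 1 : ℝ) : ℂ) * Complex.I) +
            starRingEnd ℂ a)).im]) ''
            ((fun z : Fin 2 → ℝ => ![z 1 * (c₁ + R * (1 - z 0 ^ 2) / (1 + z 0 ^ 2)), z 1 * (c₂ + 2 * R * z 0 / (1 + z 0 ^ 2))]) '' {z | τ₁ < z 0 ∧ z 0 < τ₂ ∧ 0 < z 1 ∧ z 1 < 1}) ∧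
          EqOn T'.integrand (fun p => 4 / (1 + p 0 ^ 2 + p 1 ^ 2) ^ 2) T'.domain ∧ y = KZ.of T'}) :
    c ∈ KZ.relations ⊔ AddSubgroup.closure
      ({y : KZ.FormalRep | ∃ r : KZ.IntegralRep 1, KZ.IsGeodesicPolytope 0 r.domain ∧
          EqOn r.integrand (KZ.hypDensity 0) r.domain ∧ y = KZ.of r} ∪
        {y | ∃ r : KZ.IntegralRep 2, KZ.IsGeodesicPolytope 1 r.domain ∧
          EqOn r.integrand (KZ.hypDensity 1) r.domain ∧ y = KZ.of r} ∪
        {y | ∃ (d : ℕ) (A : Matrix (Fin d) (Fin d) ℝ) (b : Fin d → ℝ) (r : KZ.IntegralRep d),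
          (∀ j l, IsAlgebraic ℚ (A j l)) ∧ (∀ j, IsAlgebraic ℚ (b j)) ∧ A.det ≠ 0 ∧
          r.domain = (fun x => A.mulVec x + b) '' {x | (∀ i, 0 < x i) ∧ ∑ i, x i < 1} ∧
          (∀ x ∈ r.domain, r.integrand x = 1) ∧ y = KZ.of r} ∪
        {y | ∃ (A : Matrix (Fin 2) (Fin 2) ℝ) (b : Fin 2 → ℝ) (r : KZ.IntegralRep 2),
          (∀ j l, IsAlgebraic ℚ (A j l)) ∧ (∀ j, IsAlgebraic ℚ (b j)) ∧ A.det ≠ 0 ∧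
          r.domain = (fun x => A.mulVec x + b) '' {p | p 0 ^ 2 + p 1 ^ 2 < 1} ∧
          (∀ x ∈ r.domain, r.integrand x = 1) ∧ y = KZ.of r} ∪
        {y | ∃ (m : ℕ) (N : KZ.IntegralRep m), m ≤ 1 ∧ N.IsRational ∧ y = KZ.of N}) := by
  obtain ⟨a, b, c₁, c₂, R, τ₁, τ₂, T', ha1, ha2, hb1, hb2, hab, h₁, h₂, hR', ht₁, ht₂, hR0, hR, hτ, hpole, hT', hT'i, rfl⟩ :=
    hc
  obtain ⟨-, ⟨T, hTd, hTi⟩, -⟩ := stub_sphereFanExists c₁ c₂ R τ₁ τ₂ h₁ h₂ hR' ht₁ ht₂ hR0 hR hτ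
  have hrot := stub_sphereRotation a b ha1 ha2 hb1 hb2 hab T T' (by rw [hTd]; exact hpole) (by rw [hT', hTd])
    (fun p _ => by rw [hTi]) hT'i
  have hT : KZ.of T ∈ KZ.relations ⊔ AddSubgroup.closure ({y : KZ.FormalRep | ∃ r : KZ.IntegralRep 1, KZ.IsGeodesicPolytope 0 r.domain ∧
          EqOn r.integrand (KZ.hypDensity 0) r.domain ∧ y = KZ.of r} ∪
        {y | ∃ r : KZ.IntegralRep 2, KZ.IsGeodesicPolytope 1 r.domain ∧
          EqOn r.integrand (KZ.hypDensity 1) r.domain ∧ y = KZ.of r} ∪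
        {y | ∃ (d : ℕ) (A : Matrix (Fin d) (Fin d) ℝ) (b : Fin d → ℝ) (r : KZ.IntegralRep d),
          (∀ j l, IsAlgebraic ℚ (A j l)) ∧ (∀ j, IsAlgebraic ℚ (b j)) ∧ A.det ≠ 0 ∧
          r.domain = (fun x => A.mulVec x + b) '' {x | (∀ i, 0 < x i) ∧ ∑ i, x i < 1} ∧
          (∀ x ∈ r.domain, r.integrand x = 1) ∧ y = KZ.of r} ∪
        {y | ∃ (A : Matrix (Fin 2) (Fin 2) ℝ) (b : Fin 2 → ℝ) (r : KZ.IntegralRep 2),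
          (∀ j l, IsAlgebraic ℚ (A j l)) ∧ (∀ j, IsAlgebraic ℚ (b j)) ∧ A.det ≠ 0 ∧
          r.domain = (fun x => A.mulVec x + b) '' {p | p 0 ^ 2 + p 1 ^ 2 < 1} ∧
          (∀ x ∈ r.domain, r.integrand x = 1) ∧ y = KZ.of r} ∪
        {y | ∃ (m : ℕ) (N : KZ.IntegralRep m), m ≤ 1 ∧ N.IsRational ∧ y = KZ.of N}) :=
    sphericalFan_mem_relations_sup_envelope ⟨c₁, c₂, R, τ₁, τ₂, T, h₁, h₂, hR', ht₁, ht₂, hR0, hR, hτ, hTd,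
      fun p _ => by rw [hTi], rfl⟩
  have : KZ.of T' = KZ.of T - (KZ.of T - KZ.of T') := by abel
  rw [this]
  exact AddSubgroup.sub_mem _ hT (AddSubgroup.mem_sup_left hrot)

/-- **Enlarging the envelope by classes that are already reachable**: if every element of `S` lies in
`relations ⊔ closure G` and `eval.ker ⊓ closure G ≤ relations`, then `eval.ker ⊓ closure (G ∪ S) ≤ relations`.
[cite: KontsevichZagier2001, §1.2] -/
theorem envelope_inf_ker_le_of_subset {G S : Set KZ.FormalRep}
    (hG : KZ.eval.ker ⊓ AddSubgroup.closure G ≤ KZ.relations)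
    (hS : S ⊆ (KZ.relations ⊔ AddSubgroup.closure G : AddSubgroup KZ.FormalRep)) :
    KZ.eval.ker ⊓ AddSubgroup.closure (G ∪ S) ≤ KZ.relations := by
  rintro c ⟨hc0, hcS⟩
  have hle : AddSubgroup.closure (G ∪ S) ≤ KZ.relations ⊔ AddSubgroup.closure G := by
    rw [AddSubgroup.closure_le]
    rintro x (hx | hx)
    · exact AddSubgroup.mem_sup_right (AddSubgroup.subset_closure hx)
    · exact hS hx
  obtain ⟨r, hr, g, hg, rfl⟩ := AddSubgroup.mem_sup.mp (hle hcS)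
  have hg0 : KZ.eval g = 0 := by
    have h1 : KZ.eval (r + g) = 0 := hc0
    have h2 : KZ.eval r = 0 := KZ.relations_le_ker_eval_holds hr
    rw [map_add, h2, zero_add] at h1
    exact h1
  exact KZ.relations.add_mem hr (hG ⟨hg0, hg⟩)

/-- **THE SPHERICAL RUNG 1 JOINS THE WEIGHT-ONE ENVELOPE**: on the subgroup generated by the weight-one envelope's
generators together with all geodesic fans of `ℚ̄`-great circles (spherical triangles with a vertex at the south pole),
the kernel of `eval` consists of Kontsevich–Zagier relations — Girard inside the calculus + Baker (spherical areas
`ℤπ/… + Σ arctan ℚ̄` glue to hyperbolic lengths and areas, Euclidean volumes and `π`). [cite: Baker1975, Theorem 2.1] -/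
theorem sphericalRungOne_inf_ker_le_relations :
    KZ.eval.ker ⊓ AddSubgroup.closure
      (({y : KZ.FormalRep | ∃ r : KZ.IntegralRep 1, KZ.IsGeodesicPolytope 0 r.domain ∧
          EqOn r.integrand (KZ.hypDensity 0) r.domain ∧ y = KZ.of r} ∪
        {y | ∃ r : KZ.IntegralRep 2, KZ.IsGeodesicPolytope 1 r.domain ∧
          EqOn r.integrand (KZ.hypDensity 1) r.domain ∧ y = KZ.of r} ∪
        {y | ∃ (d : ℕ) (A : Matrix (Fin d) (Fin d) ℝ) (b : Fin d → ℝ) (r : KZ.IntegralRep d),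
          (∀ j l, IsAlgebraic ℚ (A j l)) ∧ (∀ j, IsAlgebraic ℚ (b j)) ∧ A.det ≠ 0 ∧
          r.domain = (fun x => A.mulVec x + b) '' {x | (∀ i, 0 < x i) ∧ ∑ i, x i < 1} ∧
          (∀ x ∈ r.domain, r.integrand x = 1) ∧ y = KZ.of r} ∪
        {y | ∃ (A : Matrix (Fin 2) (Fin 2) ℝ) (b : Fin 2 → ℝ) (r : KZ.IntegralRep 2),
          (∀ j l, IsAlgebraic ℚ (A j l)) ∧ (∀ j, IsAlgebraic ℚ (b j)) ∧ A.det ≠ 0 ∧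
          r.domain = (fun x => A.mulVec x + b) '' {p | p 0 ^ 2 + p 1 ^ 2 < 1} ∧
          (∀ x ∈ r.domain, r.integrand x = 1) ∧ y = KZ.of r} ∪
        {y | ∃ (m : ℕ) (N : KZ.IntegralRep m), m ≤ 1 ∧ N.IsRational ∧ y = KZ.of N}) ∪
        ({y : KZ.FormalRep | ∃ (c₁ c₂ R τ₁ τ₂ : ℝ) (T : KZ.IntegralRep 2), IsAlgebraic ℚ c₁ ∧ IsAlgebraic ℚ c₂ ∧
          IsAlgebraic ℚ R ∧ IsAlgebraic ℚ τ₁ ∧ IsAlgebraic ℚ τ₂ ∧ 0 < R ∧ R ^ 2 = 1 + c₁ ^ 2 + c₂ ^ 2 ∧ τ₁ < τ₂ ∧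
          T.domain = (fun z : Fin 2 → ℝ => ![z 1 * (c₁ + R * (1 - z 0 ^ 2) / (1 + z 0 ^ 2)), z 1 * (c₂ + 2 * R * z 0 / (1 + z 0 ^ 2))]) ''
            {z | τ₁ < z 0 ∧ z 0 < τ₂ ∧ 0 < z 1 ∧ z 1 < 1} ∧
          EqOn T.integrand (fun p => 4 / (1 + p 0 ^ 2 + p 1 ^ 2) ^ 2) T.domain ∧ y = KZ.of T} ∪
        {y : KZ.FormalRep | ∃ (a b : ℂ) (c₁ c₂ R τ₁ τ₂ : ℝ) (T' : KZ.IntegralRep 2), IsAlgebraic ℚ a.re ∧ IsAlgebraic ℚ a.im ∧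
          IsAlgebraic ℚ b.re ∧ IsAlgebraic ℚ b.im ∧ Complex.normSq a + Complex.normSq b = 1 ∧ IsAlgebraic ℚ c₁ ∧
          IsAlgebraic ℚ c₂ ∧ IsAlgebraic ℚ R ∧ IsAlgebraic ℚ τ₁ ∧ IsAlgebraic ℚ τ₂ ∧ 0 < R ∧ R ^ 2 = 1 + c₁ ^ 2 + c₂ ^ 2 ∧
          τ₁ < τ₂ ∧
          (∀ p ∈ (fun z : Fin 2 → ℝ => ![z 1 * (c₁ + R * (1 - z 0 ^ 2) / (1 + z 0 ^ 2)), z 1 * (c₂ + 2 * R * z 0 / (1 + z 0 ^ 2))]) '' {z | τ₁ < z 0 ∧ z 0 < τ₂ ∧ 0 < z 1 ∧ z 1 < 1},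
            -(starRingEnd ℂ b) * (((p 0 : ℝ) : ℂ) + ((p 1 : ℝ) : ℂ) * Complex.I) + starRingEnd ℂ a ≠ 0) ∧
          T'.domain = (fun p : Fin 2 → ℝ =>
        ![((a * (((p 0 : ℝ) : ℂ) + ((p 1 : ℝ) : ℂ) * Complex.I) + b) / (-(starRingEnd ℂ b) * (((p 0 : ℝ) : ℂ) + ((p 1 : ℝ) : ℂ) * Complex.I) +
            starRingEnd ℂ a)).re,
          ((a * (((p 0 : ℝ) : ℂ) + ((p 1 : ℝ) : ℂ) * Complex.I) + b) / (-(starRingEnd ℂ b) * (((p 0 : ℝ) : ℂ) + ((p 1 : ℝ) : ℂ) * Complex.I) +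
            starRingEnd ℂ a)).im]) ''
            ((fun z : Fin 2 → ℝ => ![z 1 * (c₁ + R * (1 - z 0 ^ 2) / (1 + z 0 ^ 2)), z 1 * (c₂ + 2 * R * z 0 / (1 + z 0 ^ 2))]) '' {z | τ₁ < z 0 ∧ z 0 < τ₂ ∧ 0 < z 1 ∧ z 1 < 1}) ∧
          EqOn T'.integrand (fun p => 4 / (1 + p 0 ^ 2 + p 1 ^ 2) ^ 2) T'.domain ∧ y = KZ.of T'})) ≤ KZ.relations :=
  envelope_inf_ker_le_of_subset bakerEnvelope_inf_ker_le_relations (by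
    rintro c (hc | hc)
    · exact sphericalFan_mem_relations_sup_envelope hc
    · exact sphericalRotatedFan_mem_relations_sup_envelope hc)

end Summit.KontsevichZagierPeriods.HyperbolicBloch.OffTetraSectorKernel

end
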